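import Summits.KontsevichZagierPeriods.KontsevichZagierPeriods.Theorems.StuffleInKZ.Negative.Core
import Literature.NumberTheory.Transcendental.KZFibredRelations
import Literature.NumberTheory.Transcendental.SemialgebraicMapsProofs
import Literature.Barriers.KontsevichZagierPeriods.AlgebraicPrimitivesObstruction

/-!
# `StuffleInKZ` (stmt-KontsevichZagierPeriods-3931): negative side — the ALGEBRAIC SHADOW, an
# additive invariant of `KZ.FormalRep` compatible with Newton–Leibniz

Companion of `Negative/Core.lean`, `AdditivityOnly.lean`, `NewtonLeibnizFree.lean` (cdisprove unit
of the crux `StuffleInKZ`, route `FurushoPentagon`; cycle 3). Cycle 2 left OPEN whether a change of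
variables is NECESSARY in a move chain for the stuffle, for want of an additive invariant of
`KZ.FormalRep` compatible with the Newton–Leibniz rule (3) other than `KZ.eval` itself. This file
supplies one; its consequences (rule (2) is independent of (1)+(3), the kernel conjecture fails for
the CoV-free calculus, reduction of the crux) are in `ChangeOfVariablesFree.lean`.

**The invariant.** Read every representation of dimension `≥ 1` as a family over its first
coordinate and take the marginal density `KZ.sliceEval c : ℝ → ℝ` (tree: `KZFibredRelations.lean`,
`KZ.sliceValue`). Rules (1a), (1b) and every Newton–Leibniz move over a base of dimension `≥ 1`
are FIBRED over the first coordinate, and the tree's `KZ.sliceEval_ae_eq_zero` says they do not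
change `sliceEval` almost everywhere. The only non-fibred generators of the CoV-free sub-calculus
`covFreeRelations = closure (domainAddRel ∪ integrandAddRel ∪ newtonLeibnizRel)` are the
Newton–Leibniz moves `∫_a^b F' = F(b) − F(a)` from dimension `1` to dimension `0`, whose
`sliceEval` is the ℚ-SEMIALGEBRAIC function `1_{[a,b]} F'` (`sliceValue_dim_one`,
`isSemialgebraicFunOn_indicator`). Hence (`covFreeRelations_le_algShadow`):

  every `c ∈ covFreeRelations` has an ALGEBRAIC SHADOW — `sliceEval c` agrees a.e. with a
  `ℚ`-semialgebraic function of one variable (`HasAlgShadow`; an additive subgroup `algShadow` by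
  Tarski–Seidenberg, `IsSemialgebraicFunOn.add_holds`);

indeed ALL fibred moves (including fibred changes of variables `Φ z 0 = z 0`) together with ALL
Newton–Leibniz moves have algebraic shadows (`closure_fibred_nl_le_algShadow`). A change of
variables mixing the first coordinate destroys this (`ChangeOfVariablesFree.lean`).

Sources: M. Kontsevich, D. Zagier, *Periods* (2001), §1.2 rules (1)–(3); J. Ayoub, *Une version
relative de la conjecture des périodes de Kontsevich–Zagier*, Ann. of Math. 181 (2015), §1 (rules
relative to a base); J. Bochnak, M. Coste, M.-F. Roy, *Real Algebraic Geometry* (1998), Prop. 2.2.6.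
-/

noncomputable section

namespace Summit.KontsevichZagierPeriods.Theorems.StuffleInKZ.Negative

open MeasureTheory Set Filter
open Literature.NumberTheory.Transcendental
open Literature.NumberTheory.Transcendental.KZ
open Literature.ModelTheory.ExponentialFields (IsSemialgebraic isSemialgebraic_univ
  isSemialgebraic_setOf_eval_pos isSemialgebraic_setOf_eval_eq_zero isSemialgebraic_setOf_eval_le)
open MvPolynomial (aeval X C)
open Literature.NumberTheory.Transcendental.MZV (IsAdmissible stuffle)
open Summit.KontsevichZagierPeriods.KontsevichZagierPeriods.Theses.FurushoPentagon (StuffleInKZ)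

variable {n m : ℕ}

/-! ## §1 The change-of-variables-free sub-calculus -/

/-- The closure of rules (1a) + (1b) + (3): the KZ calculus WITHOUT changes of variables. [folklore] -/
def covFreeRelations : AddSubgroup FormalRep :=
  AddSubgroup.closure (domainAddRel ∪ integrandAddRel ∪ newtonLeibnizRel)

/-- The CoV-free closure is part of `relations`. [folklore] -/
theorem covFreeRelations_le_relations : covFreeRelations ≤ relations :=
  AddSubgroup.closure_mono fun _ hc => hc.elim (fun h => Or.inl (Or.inl h)) Or.inr

/-- Newton–Leibniz moves are CoV-free relations. [folklore] -/
theorem newtonLeibnizRel_subset_covFreeRelations : newtonLeibnizRel ⊆ covFreeRelations :=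
  fun _ hc => AddSubgroup.subset_closure (Or.inr hc)

/-! ## §2 The algebraic shadow -/

/-- `c` has an **algebraic shadow**: its first-axis marginal density `sliceEval c` agrees almost
everywhere with a `ℚ`-semialgebraic function of one real variable. [folklore] -/
def HasAlgShadow (c : FormalRep) : Prop :=
  ∃ g : (Fin 1 → ℝ) → ℝ, IsSemialgebraicFunOn ℚ univ g ∧ sliceEval c =ᵐ[volume] fun s => g fun _ => s

/-- A combination whose marginal density vanishes a.e. has an algebraic shadow (`g = 0`). [folklore] -/
theorem hasAlgShadow_of_ae_eq_zero {c : FormalRep} (h : sliceEval c =ᵐ[volume] 0) : HasAlgShadow c :=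
  ⟨fun x => aeval x (0 : MvPolynomial (Fin 1) ℚ), isSemialgebraicFunOn_aeval isSemialgebraic_univ _,
    h.trans (Eventually.of_forall fun s => by simp)⟩

/-- Algebraic shadows add (Tarski–Seidenberg: `IsSemialgebraicFunOn.add_holds`). [folklore] -/
theorem HasAlgShadow.add {c d : FormalRep} (hc : HasAlgShadow c) (hd : HasAlgShadow d) :
    HasAlgShadow (c + d) := by
  obtain ⟨g, hg, hcg⟩ := hc
  obtain ⟨h, hh, hdh⟩ := hd
  refine ⟨g + h, IsSemialgebraicFunOn.add_holds hg hh, ?_⟩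
  rw [map_add]
  exact hcg.add hdh

/-- Algebraic shadows negate. [folklore] -/
theorem HasAlgShadow.neg {c : FormalRep} (hc : HasAlgShadow c) : HasAlgShadow (-c) := by
  obtain ⟨g, hg, hcg⟩ := hc
  refine ⟨-g, hg.neg, ?_⟩
  rw [map_neg]
  exact hcg.neg

/-- The combinations with an algebraic shadow form a subgroup of `FormalRep`. [folklore] -/
def algShadow : AddSubgroup FormalRep where
  carrier := {c | HasAlgShadow c}
  zero_mem' := hasAlgShadow_of_ae_eq_zero (by simp)
  add_mem' := HasAlgShadow.add
  neg_mem' := HasAlgShadow.neg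

/-- Membership in `algShadow` is `HasAlgShadow`. [folklore] -/
@[simp] theorem mem_algShadow {c : FormalRep} : c ∈ algShadow ↔ HasAlgShadow c := Iff.rfl

/-- **Fibred relations have algebraic shadow `0`** (tree: `KZ.sliceEval_ae_eq_zero`). -/
theorem fibredRelations_le_algShadow : fibredRelations ≤ algShadow :=
  fun _ hc => hasAlgShadow_of_ae_eq_zero (sliceEval_ae_eq_zero hc)

/-! ### The non-fibred generators: Newton–Leibniz from dimension `1` to dimension `0` -/

/-- `vecCons s (elim) : Fin 1 → ℝ` is the constant vector `s`. [folklore] -/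
theorem vecCons_fin_zero (s : ℝ) (x : Fin 0 → ℝ) : Matrix.vecCons s x = fun _ => s := by
  funext i
  exact Matrix.cons_val_fin_one s x i

/-- Lebesgue measure of `ℝ⁰` is `1`. [folklore] -/
theorem volume_univ_fin_zero : (volume : Measure (Fin 0 → ℝ)) univ = 1 := by
  rw [volume_pi, Measure.pi_univ]
  simp

/-- **Slices of a one-dimensional representation are point evaluations**:
`sliceValue r s = 1_σ(s) f(s)`. [folklore] -/
theorem sliceValue_dim_one (r : IntegralRep (0 + 1)) (s : ℝ) :
    sliceValue r s = r.domain.indicator r.integrand (fun _ => s) := by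
  rw [sliceValue_def]
  simp_rw [vecCons_fin_zero]
  by_cases hs : (fun _ : Fin (0 + 1) => s) ∈ r.domain
  · rw [indicator_of_mem hs]
    have hset : {x : Fin 0 → ℝ | (fun _ : Fin (0 + 1) => s) ∈ r.domain} = univ :=
      eq_univ_of_forall fun _ => hs
    rw [hset, Measure.restrict_univ, integral_const, measureReal_def, volume_univ_fin_zero]
    simp
  · rw [indicator_of_notMem hs]
    have hset : {x : Fin 0 → ℝ | (fun _ : Fin (0 + 1) => s) ∈ r.domain} = ∅ :=
      eq_empty_of_forall_notMem fun _ h => hs h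
    rw [hset, Measure.restrict_empty, integral_zero_measure]

/-- **Extension by zero of a semialgebraic function is semialgebraic** (the graph is the union of
the graph over `σ` and `σᶜ × {0}`). [folklore] -/
theorem isSemialgebraicFunOn_indicator {σ : Set (Fin m → ℝ)} {f : (Fin m → ℝ) → ℝ}
    (hσ : IsSemialgebraic ℚ σ) (hf : IsSemialgebraicFunOn ℚ σ f) :
    IsSemialgebraicFunOn ℚ univ (σ.indicator f) := by
  rw [isSemialgebraicFunOn_iff] at hf ⊢
  have hlast : IsSemialgebraic ℚ {z : Fin (m + 1) → ℝ | aeval z (X (Fin.last m) : MvPolynomial _ ℚ) = 0} :=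
    isSemialgebraic_setOf_eval_eq_zero _
  convert hf.union (hσ.compl.setOf_init_mem.inter hlast) using 1
  ext z
  simp only [mem_univ, true_and, mem_setOf_eq, mem_union, mem_inter_iff, MvPolynomial.aeval_X,
    mem_compl_iff]
  by_cases hz : Fin.init z ∈ σ
  · simp [hz]
  · simp [hz]

/-- A one-dimensional representation has an algebraic shadow: its own integrand extended by zero. -/
theorem hasAlgShadow_of_dim_one (r : IntegralRep (0 + 1)) : HasAlgShadow (of r) :=
  ⟨r.domain.indicator r.integrand,
    isSemialgebraicFunOn_indicator r.isSemialgebraic_domain r.isSemialgebraicFunOn_integrand,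
    Eventually.of_forall fun s => by rw [sliceEval_of, sliceValue_dim_one]⟩

/-- A constant (dimension `0`) has algebraic shadow `0`. -/
theorem hasAlgShadow_of_dim_zero (r : IntegralRep 0) : HasAlgShadow (of r) :=
  hasAlgShadow_of_ae_eq_zero (by rw [sliceEval_of_zero])

/-- **Every Newton–Leibniz move has an algebraic shadow**: over a base of dimension `≥ 1` it is
fibred (shadow `0`); from dimension `1` to `0` its shadow is `1_{[a,b]} F'`. -/
theorem hasAlgShadow_of_mem_newtonLeibnizRel {c : FormalRep} (hc : c ∈ newtonLeibnizRel) :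
    HasAlgShadow c := by
  obtain ⟨k, r, r', a, b, F, hF, ha, hb, hab, hdom, hcont, hderiv, hr', rfl⟩ := hc
  cases k with
  | zero =>
    rw [sub_eq_add_neg]
    exact (hasAlgShadow_of_dim_one r).add (hasAlgShadow_of_dim_zero r').neg
  | succ k =>
    have hmem : of r - of r' ∈ fibredNewtonLeibnizRel :=
      ⟨⟨k + 1, r, r', a, b, F, hF, ha, hb, hab, hdom, hcont, hderiv, hr', rfl⟩, k, r, r', rfl⟩
    exact mem_algShadow.mp
      (fibredRelations_le_algShadow (mem_fibredRelations_of_mem_fibredNewtonLeibnizRel hmem))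

/-- **The CoV-free sub-calculus has algebraic shadows.** -/
theorem covFreeRelations_le_algShadow : covFreeRelations ≤ algShadow := by
  refine (AddSubgroup.closure_le _).mpr ?_
  rintro c ((hc | hc) | hc)
  · exact fibredRelations_le_algShadow (mem_fibredRelations_of_mem_domainAddRel hc)
  · exact fibredRelations_le_algShadow (mem_fibredRelations_of_mem_integrandAddRel hc)
  · exact hasAlgShadow_of_mem_newtonLeibnizRel hc

/-- Stronger: ALL fibred moves (including fibred changes of variables) and ALL Newton–Leibniz moves
together have algebraic shadows. -/
theorem closure_fibred_nl_le_algShadow :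
    AddSubgroup.closure (fibredGenerators ∪ newtonLeibnizRel) ≤ algShadow := by
  refine (AddSubgroup.closure_le _).mpr ?_
  rintro c (hc | hc)
  · exact fibredRelations_le_algShadow (fibredGenerators_subset_fibredRelations hc)
  · exact hasAlgShadow_of_mem_newtonLeibnizRel hc

/-! ## §2b A shadow that is NOT algebraic: `L s = log (s+2) − log (s+1)` on `(0,1)`

Used by `ChangeOfVariablesFree.lean`: a combination whose marginal is a.e. `L` on `(0,1)` has no
algebraic shadow (`not_hasAlgShadow_of_ae_eq_L`). -/

namespace LogShadow


/-- `[0, 1] ⊆ ℝ¹` is `ℚ`-semialgebraic. [folklore] -/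
theorem isSemialgebraic_Icc01 : IsSemialgebraic ℚ {x : Fin 1 → ℝ | x 0 ∈ Icc (0 : ℝ) 1} := by
  have h : {x : Fin 1 → ℝ | x 0 ∈ Icc (0 : ℝ) 1} =
      {z | aeval z (0 : MvPolynomial (Fin 1) ℚ) ≤ aeval z (X 0 : MvPolynomial (Fin 1) ℚ)} ∩
        {z | aeval z (X 0 : MvPolynomial (Fin 1) ℚ) ≤ aeval z (1 : MvPolynomial (Fin 1) ℚ)} := by
    ext z
    simp
  rw [h]
  exact (isSemialgebraic_setOf_eval_le _ _).inter (isSemialgebraic_setOf_eval_le _ _)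

/-- The shadow function `L s = log (s+2) − log (s+1)`. -/
def L (s : ℝ) : ℝ := Real.log (s + 2) - Real.log (s + 1)

/-- `L' (t) = −1/((t+1)(t+2))`: a rational function with a SIMPLE POLE at `t = −1`. [folklore] -/
theorem hasDerivAt_L {t : ℝ} (ht : t ∈ Ioo (0 : ℝ) 1) :
    HasDerivAt L (-1 / ((t + 1) * (t + 2))) t := by
  have h1 : t + 1 ≠ 0 := by linarith [ht.1]
  have h2 : t + 2 ≠ 0 := by linarith [ht.1]
  have hA : HasDerivAt (fun s => Real.log (s + 2)) (1 / (t + 2)) t := by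
    have := ((hasDerivAt_id t).add_const 2).log h2
    simpa using this
  have hB : HasDerivAt (fun s => Real.log (s + 1)) (1 / (t + 1)) t := by
    have := ((hasDerivAt_id t).add_const 1).log h1
    simpa using this
  have h := hA.sub hB
  have e : 1 / (t + 2) - 1 / (t + 1) = -1 / ((t + 1) * (t + 2)) := by
    field_simp
    ring
  rw [e] at h
  exact h

/-- `L` is continuous on `(0,1)`. [folklore] -/
theorem continuousOn_L : ContinuousOn L (Ioo (0 : ℝ) 1) :=
  fun _ ht => (hasDerivAt_L ht).continuousAt.continuousWithinAt

open scoped Polynomial.Bivariate in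
/-- **`L` satisfies no non-trivial polynomial identity on `(0,1)`** (simple-pole descent at
`s = −1`, `NoSemialgPrimKernel.eq_zero_of_evalEval_eq_zero`). -/
theorem eq_zero_of_evalEval_L (P : Polynomial (Polynomial ℝ))
    (hP : ∀ t ∈ Ioo (0 : ℝ) 1, P.evalEval t (L t) = 0) : P = 0 := by
  have hV : (Polynomial.X + Polynomial.C (2 : ℝ)).eval (-1) ≠ 0 := by norm_num
  have hN : (Polynomial.C (-1 : ℝ)).eval (-1) ≠ 0 := by norm_num
  have hDN : ∀ t ∈ Ioo (0 : ℝ) 1,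
      ((Polynomial.X - Polynomial.C (-1 : ℝ)) * (Polynomial.X + Polynomial.C 2)).eval t *
          (-1 / ((t + 1) * (t + 2))) = (Polynomial.C (-1 : ℝ)).eval t := by
    intro t ht
    have h1 : t + 1 ≠ 0 := by linarith [ht.1]
    have h2 : t + 2 ≠ 0 := by linarith [ht.1]
    simp only [Polynomial.eval_mul, Polynomial.eval_sub, Polynomial.eval_add, Polynomial.eval_X,
      Polynomial.eval_C, sub_neg_eq_add]
    field_simp
  exact Literature.Barriers.KontsevichZagierPeriods.KZ.NoSemialgPrimKernel.eq_zero_of_evalEval_eq_zero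
    (G := L) (fun t ht => hasDerivAt_L ht) hDN hV hN P.natDegree P le_rfl hP

open scoped Polynomial.Bivariate in
/-- `t ↦ P(t, L t)` is continuous on `(0,1)`. [folklore] -/
theorem continuousOn_evalEval_L (P : Polynomial (Polynomial ℝ)) :
    ContinuousOn (fun t => P.evalEval t (L t)) (Ioo (0 : ℝ) 1) := by
  have h : (fun t => P.evalEval t (L t)) =
      fun t => ∑ j ∈ Finset.range (P.natDegree + 1), (P.coeff j).eval t * L t ^ j := by
    funext t
    conv_lhs => rw [P.as_sum_range_C_mul_X_pow]
    simp [Polynomial.evalEval_finsetSum, Polynomial.evalEval_C]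
  rw [h]
  refine continuousOn_finsetSum _ fun j _ => ?_
  exact ((P.coeff j).continuous.continuousOn).mul (continuousOn_L.pow j)

open scoped Polynomial.Bivariate in
/-- **A combination whose first-axis marginal is a.e. `L` on `(0,1)` has no algebraic shadow**:
a `ℚ`-semialgebraic `g` agreeing a.e. with the marginal satisfies a polynomial identity on `[0,1]`
(`NoSemialgPrimKernel.exists_ne_zero_evalEval_eq_zero`), which passes to `L` a.e., then everywhere
on `(0,1)` by continuity, contradicting `eq_zero_of_evalEval_L`. -/
theorem not_hasAlgShadow_of_ae_eq_L {c : FormalRep}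
    (hc : ∀ᵐ s ∂volume, s ∈ Ioo (0 : ℝ) 1 → sliceEval c s = L s) : ¬ HasAlgShadow c := by
  rintro ⟨g, hg, hae⟩
  obtain ⟨P, hP0, hPv⟩ :=
    Literature.Barriers.KontsevichZagierPeriods.KZ.NoSemialgPrimKernel.exists_ne_zero_evalEval_eq_zero
      (hg.mono (subset_univ _) isSemialgebraic_Icc01)
  apply hP0
  apply eq_zero_of_evalEval_L
  have h1 : ∀ᵐ t ∂(volume.restrict (Ioo (0 : ℝ) 1)), P.evalEval t (L t) = (0 : ℝ → ℝ) t := by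
    rw [ae_restrict_iff' measurableSet_Ioo]
    filter_upwards [hae, hc] with t ht hct hmem
    have hL : L t = g fun _ => t := by rw [← ht, hct hmem]
    rw [hL]
    exact hPv t (Ioo_subset_Icc_self hmem)
  have h2 := Measure.eqOn_open_of_ae_eq h1 isOpen_Ioo (continuousOn_evalEval_L P) continuousOn_const
  exact fun t ht => h2 ht

end LogShadow

end Summit.KontsevichZagierPeriods.Theorems.StuffleInKZ.Negative
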